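import Summits.CriticalPhenomena.Ising3DConformalLimit.Theorems.SubPtolemyInterlacingSubPtolemyFloorScreenedGradient
import Summits.CriticalPhenomena.Ising3DConformalLimit.Theorems.SubPtolemyInterlacingSubPtolemyFloorScreenedAxisLower
import Summits.CriticalPhenomena.Ising3DConformalLimit.Theorems.SubPtolemyInterlacingSubPtolemyFloorScreenedEtaBound
import Summits.CriticalPhenomena.Ising3DConformalLimit.Theorems.SubPtolemyInterlacingSubPtolemyFloorHybridCloses
import Summits.CriticalPhenomena.Ising3DConformalLimit.Theorems.SubPtolemyInterlacingSubPtolemyFloorConditionalClosings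
import Literature.Probability.LatticeModels.CriticalTwoPointDCPLowerHolds
import HarnessLib

/-!
# `SubPtolemyFloor` ⇐ screening gain ∧ η-existence: the kernel certificate of the line
# `source-cluster-screening` (crux item stmt-CriticalPhenomena-15703, route decl
# `Summit.CriticalPhenomena.Ising3DConformalLimit.Theses.SubPtolemyInterlacing.SubPtolemyFloor`;
# checked skeleton `Cruxes/SubPtolemyFloor/Lines/Source_cluster_screening.lean`, lead seat
# `prover-line-stmt-CriticalPhenomena-15703-c3-0`; line card `Lines/Source_cluster_screening.md`)

Notation (prose only): `G(x) = ⟨σ₀σ_x⟩_{β_c(3)}`, `L⋆ = log₂(1+√2) = 1.27155` (the Ptolemy threshold of the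
route; the crux is one-sided `η(3) < L⋆ - 1 = 0.27155`), and for `s ≥ 0`, `C > 0` the three currencies of
the line (stated UNFOLDED below, because they are posited by the line and live only in the non-importable
skeleton): the **screened torus Lemma 2.5** `STL25(s,C)` — Duminil-Copin–Panis' Lemma 2.5 SUMMED over the
neighbour pairs of `Λ_n` on every even torus at `β_c(3)`, with a polynomial gain `C n^{-s}` on the right
(`s = 0`, `C = 1` is the printed lemma; `s > 0` keeps the SCREENING of the reflected connection `y ↔ ℍ` by
the deleted source cluster `𝒞_n(0) ∋ x ∼ y`, which step 4 of the printed proof discards) — and its two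
consequences, the screened reflected-gradient inequality (Thm 1.2 with `c₀ n^{s}`) and the screened axial
lower bound (Thm 1.3 with `c₁ n^{s}`), landed as the three stub theorems of wave 1:
`screenedGradient_of_screenedLemma25` (S1, p142397), `screenedAxisLower_of_screenedGradient` (S2, p141419),
`etaBound_of_screenedAxisLower` (S3, p141599).

This file composes them (pure logic over tree theorems; no definition, no named fact, no sorry):

* `one_add_eta_le_of_screenedLemma25` — **frontier dividend**: `STL25(s,C)` with ANY `s ≥ 0` gives, for
  every `η` with `HasIsingExponentEta 3 η`, `1 + η ≤ (3 - s)/2`, i.e. `η ≤ (1 - s)/2` (the printed Thm 1.5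
  is `s = 0`); every partial screening gain improves the conditional frontier.
* `conditionalEta_of_screeningGain` — the ENGINE `∃ s > 3 - 2L⋆, ∃ C > 0, STL25(s,C)` ALONE implies the
  conditional exponent inequality `∀ η, HasIsingExponentEta 3 η → η < L⋆ - 1` (= the hypothesis of the
  landed `SubPtolemyFloorHybrid.conditionalEta_closes`, p135087, "Option B" of four leads).
* `subPtolemyFloor_of_screeningGain` — **the line's composition**: engine ∧ (`η(3)` exists) ⟹ the crux BY
  NAME (the skeleton theorem `SubPtolemyFloor_of` with its two open stubs as hypotheses).
* `screening_closes` — **route-level reading**: `Interlacing → engine → MoebiusLimit → Ising3DConformalLimit`;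
  inside the route the η-existence stub is supplied by r4 (`MoebiusLimit`), so the engine is the ONLY open
  piece this line adds.
* `screenedLemma25_zero_one` — **calibration**: `STL25(0,1)` is a theorem (the tree's `DCPLower.lemma25_torus`
  summed over pairs), so the engine's format is the printed one and the whole difficulty is the exponent `s`.

References: H. Duminil-Copin, R. Panis, *New lower bounds for the (near) critical Ising and φ⁴ models'
two-point functions*, CMP 406 (2025), arXiv:2404.05700, Lemma 2.5, Theorems 1.2, 1.3, 1.5; G. Lawler,
*Intersections of random walks* (1991), §5.1 (Brownian calibration of the screening exponent);
H. Duminil-Copin, ICM 2022, §8.4 (existence of η(3) is open).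
-/

noncomputable section

open Finset Filter Topology

namespace Summit.CriticalPhenomena.Ising3DConformalLimit.SubPtolemyFloorScreening

open Literature.Probability.LatticeModels Literature.Probability.LatticeModels.DCPLower
  Literature.Probability.LatticeModels.DCPNearCritical
open Summit.CriticalPhenomena.Ising3DConformalLimit.Theses.SubPtolemyInterlacing
open scoped ENNReal symmDiff Classical

/-- **Frontier dividend.** For every `s ≥ 0` and `C > 0`: the screened torus Lemma 2.5 `STL25(s,C)`
(unfolded) implies `1 + η ≤ (3 - s)/2` for every logarithmic exponent `η` of the critical two-point
function of `ℤ³` — the composition S3 ∘ S2 ∘ S1 of the landed stubs; `s = 0` is Duminil-Copin–Panis'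
`η ≤ 1/2`. [cite: DuminilCopinPanis2025LowerBounds, Theorems 1.2, 1.3, 1.5 and Lemma 2.5] -/
theorem one_add_eta_le_of_screenedLemma25 (s C : ℝ) (hs : 0 ≤ s) (hC : 0 < C)
    (hE : ∀ (n : ℕ) (_hn : 1 ≤ n) (L : ℕ) [NeZero L] (hL : Even L) (hnL : 4 * n + 2 ≤ L) (δ : Fin 3 × Bool),
      (∑ x ∈ box 3 n, ∑ y ∈ box 3 n,
        if (zdGraph 3).Adj x y then
          ∑' nc : edgesIn (torusGraph 3 L) univ → ℕ,
            ind (csources (torusGraph 3 L) univ nc = ∅ ∧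
                CSupp (torusGraph 3 L) univ (edgesIn (torusGraph 3 L) univ) nc) *
              cweight (torusGraph 3 L) univ (criticalBeta 3) nc *
              (ind (¬ (isFoldable_dir hL (by omega) n δ).ConnFix ((isFoldable_dir hL (by omega) n δ).fold nc)
                      (Torus.proj L (0 : Site 3)) ∧
                    ¬ (isFoldable_dir hL (by omega) n δ).ConnFix ((isFoldable_dir hL (by omega) n δ).fold nc)
                      (Torus.proj L x) ∧
                    (isFoldable_dir hL (by omega) n δ).ConnFix ((isFoldable_dir hL (by omega) n δ).fold nc)
                      (Torus.proj L y)) *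
                ENNReal.ofReal (isingTwoPoint (torusGraph 3 L)
                  (((box 3 n).filter fun z => ¬ (isFoldable_dir hL (by omega) n δ).ConnFix
                      ((isFoldable_dir hL (by omega) n δ).fold nc) (Torus.proj L z)).image (Torus.proj L))
                  (criticalBeta 3) 0 .free (Torus.proj L (0 : Site 3)) (Torus.proj L x)))
        else 0) ≤
      ENNReal.ofReal (C * (n : ℝ) ^ (-s)) *
        ∑ x ∈ box 3 n, ∑ y ∈ box 3 n,
          if (zdGraph 3).Adj x y then
            (currentZ (torusGraph 3 L) univ (criticalBeta 3) (edgesIn (torusGraph 3 L) univ)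
                  ({Torus.proj L (0 : Site 3)} ∆ {Torus.proj L x}) -
                currentZ (torusGraph 3 L) univ (criticalBeta 3) (edgesIn (torusGraph 3 L) univ)
                  ({Torus.proj L (0 : Site 3)} ∆ {dirTheta L n δ (Torus.proj L x)})) *
              ENNReal.ofReal (isingTwoPoint (torusGraph 3 L) univ (criticalBeta 3) 0 .free (Torus.proj L y)
                (dirTheta L n δ (Torus.proj L y)))
          else 0)
    (η : ℝ) (hη : HasIsingExponentEta 3 η) : 1 + η ≤ (3 - s) / 2 :=
  etaBound_of_screenedAxisLower s hs
    (screenedAxisLower_of_screenedGradient s hs (screenedGradient_of_screenedLemma25 s C hs hC hE)) η hη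

/-- **The engine alone gives the conditional exponent inequality ("Option B").** If the screened torus
Lemma 2.5 holds with SOME gain `s > 3 - 2·log₂(1+√2) = 0.4569` and `C > 0`, then every logarithmic exponent
`η` of `⟨σ₀σ_x⟩_{β_c(3)}` satisfies `η < log₂(1+√2) - 1` — because `1 + η ≤ (3-s)/2 < log₂(1+√2)`.
This is exactly the hypothesis of `SubPtolemyFloorHybrid.conditionalEta_closes` (p135087).
[cite: DuminilCopinPanis2025LowerBounds, Theorem 1.5 (shape of the deduction)] -/
theorem conditionalEta_of_screeningGain
    (hE : ∃ s C : ℝ, 3 - 2 * Real.logb 2 (1 + Real.sqrt 2) < s ∧ 0 < C ∧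
      ∀ (n : ℕ) (_hn : 1 ≤ n) (L : ℕ) [NeZero L] (hL : Even L) (hnL : 4 * n + 2 ≤ L) (δ : Fin 3 × Bool),
      (∑ x ∈ box 3 n, ∑ y ∈ box 3 n,
        if (zdGraph 3).Adj x y then
          ∑' nc : edgesIn (torusGraph 3 L) univ → ℕ,
            ind (csources (torusGraph 3 L) univ nc = ∅ ∧
                CSupp (torusGraph 3 L) univ (edgesIn (torusGraph 3 L) univ) nc) *
              cweight (torusGraph 3 L) univ (criticalBeta 3) nc *
              (ind (¬ (isFoldable_dir hL (by omega) n δ).ConnFix ((isFoldable_dir hL (by omega) n δ).fold nc)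
                      (Torus.proj L (0 : Site 3)) ∧
                    ¬ (isFoldable_dir hL (by omega) n δ).ConnFix ((isFoldable_dir hL (by omega) n δ).fold nc)
                      (Torus.proj L x) ∧
                    (isFoldable_dir hL (by omega) n δ).ConnFix ((isFoldable_dir hL (by omega) n δ).fold nc)
                      (Torus.proj L y)) *
                ENNReal.ofReal (isingTwoPoint (torusGraph 3 L)
                  (((box 3 n).filter fun z => ¬ (isFoldable_dir hL (by omega) n δ).ConnFix
                      ((isFoldable_dir hL (by omega) n δ).fold nc) (Torus.proj L z)).image (Torus.proj L))
                  (criticalBeta 3) 0 .free (Torus.proj L (0 : Site 3)) (Torus.proj L x)))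
        else 0) ≤
      ENNReal.ofReal (C * (n : ℝ) ^ (-s)) *
        ∑ x ∈ box 3 n, ∑ y ∈ box 3 n,
          if (zdGraph 3).Adj x y then
            (currentZ (torusGraph 3 L) univ (criticalBeta 3) (edgesIn (torusGraph 3 L) univ)
                  ({Torus.proj L (0 : Site 3)} ∆ {Torus.proj L x}) -
                currentZ (torusGraph 3 L) univ (criticalBeta 3) (edgesIn (torusGraph 3 L) univ)
                  ({Torus.proj L (0 : Site 3)} ∆ {dirTheta L n δ (Torus.proj L x)})) *
              ENNReal.ofReal (isingTwoPoint (torusGraph 3 L) univ (criticalBeta 3) 0 .free (Torus.proj L y)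
                (dirTheta L n δ (Torus.proj L y)))
          else 0) :
    ∀ η : ℝ, HasIsingExponentEta 3 η → η < Real.logb 2 (1 + Real.sqrt 2) - 1 := by
  intro η hη
  obtain ⟨s, C, hs, hC, h⟩ := hE
  have hs0 : 0 ≤ s := by linarith [SubPtolemyFloorNegative.threshold_lt_three_halves]
  have hb := one_add_eta_le_of_screenedLemma25 s C hs0 hC h η hη
  linarith

/-- **The line's composition, landed: screening gain ∧ η-existence ⟹ `SubPtolemyFloor` (route decl, by
name).** The two hypotheses are the skeleton's two open stubs `stub_screenedLemma25` (engine, a new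
screening exponent) and `stub_etaExists` (existence of `η(3)`, open stand-alone); the conclusion is reached
through the landed bridge `SubPtolemyFloorPlusWall.subPtolemyFloor_of_hasIsingExponentEta` (p131889).
[cite: DuminilCopinPanis2025LowerBounds, Theorem 1.5 (shape of the deduction)] -/
theorem subPtolemyFloor_of_screeningGain
    (hE : ∃ s C : ℝ, 3 - 2 * Real.logb 2 (1 + Real.sqrt 2) < s ∧ 0 < C ∧
      ∀ (n : ℕ) (_hn : 1 ≤ n) (L : ℕ) [NeZero L] (hL : Even L) (hnL : 4 * n + 2 ≤ L) (δ : Fin 3 × Bool),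
      (∑ x ∈ box 3 n, ∑ y ∈ box 3 n,
        if (zdGraph 3).Adj x y then
          ∑' nc : edgesIn (torusGraph 3 L) univ → ℕ,
            ind (csources (torusGraph 3 L) univ nc = ∅ ∧
                CSupp (torusGraph 3 L) univ (edgesIn (torusGraph 3 L) univ) nc) *
              cweight (torusGraph 3 L) univ (criticalBeta 3) nc *
              (ind (¬ (isFoldable_dir hL (by omega) n δ).ConnFix ((isFoldable_dir hL (by omega) n δ).fold nc)
                      (Torus.proj L (0 : Site 3)) ∧
                    ¬ (isFoldable_dir hL (by omega) n δ).ConnFix ((isFoldable_dir hL (by omega) n δ).fold nc)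
                      (Torus.proj L x) ∧
                    (isFoldable_dir hL (by omega) n δ).ConnFix ((isFoldable_dir hL (by omega) n δ).fold nc)
                      (Torus.proj L y)) *
                ENNReal.ofReal (isingTwoPoint (torusGraph 3 L)
                  (((box 3 n).filter fun z => ¬ (isFoldable_dir hL (by omega) n δ).ConnFix
                      ((isFoldable_dir hL (by omega) n δ).fold nc) (Torus.proj L z)).image (Torus.proj L))
                  (criticalBeta 3) 0 .free (Torus.proj L (0 : Site 3)) (Torus.proj L x)))
        else 0) ≤
      ENNReal.ofReal (C * (n : ℝ) ^ (-s)) *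
        ∑ x ∈ box 3 n, ∑ y ∈ box 3 n,
          if (zdGraph 3).Adj x y then
            (currentZ (torusGraph 3 L) univ (criticalBeta 3) (edgesIn (torusGraph 3 L) univ)
                  ({Torus.proj L (0 : Site 3)} ∆ {Torus.proj L x}) -
                currentZ (torusGraph 3 L) univ (criticalBeta 3) (edgesIn (torusGraph 3 L) univ)
                  ({Torus.proj L (0 : Site 3)} ∆ {dirTheta L n δ (Torus.proj L x)})) *
              ENNReal.ofReal (isingTwoPoint (torusGraph 3 L) univ (criticalBeta 3) 0 .free (Torus.proj L y)
                (dirTheta L n δ (Torus.proj L y)))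
          else 0)
    (hη : ∃ η : ℝ, HasIsingExponentEta 3 η) : SubPtolemyFloor := by
  obtain ⟨η, hη⟩ := hη
  exact SubPtolemyFloorPlusWall.subPtolemyFloor_of_hasIsingExponentEta η hη
    (conditionalEta_of_screeningGain hE η hη)

/-- **Route-level reading: with the engine in hand the route closes WITHOUT the η-existence stub.**
`Interlacing → (screening gain) → MoebiusLimit → Ising3DConformalLimit`: the Möbius limit of r4 makes `η`
exist (inside `SubPtolemyFloorHybrid.conditionalEta_closes`), and the engine puts it below `log₂(1+√2) - 1`.
So, for the ROUTE, the screening exponent is the only open content this line adds to r2 and r4.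
[cite: DuminilCopinICM2022, §8.4 (existence of η(3) and the scaling limit are open)] -/
theorem screening_closes (hI : Interlacing)
    (hE : ∃ s C : ℝ, 3 - 2 * Real.logb 2 (1 + Real.sqrt 2) < s ∧ 0 < C ∧
      ∀ (n : ℕ) (_hn : 1 ≤ n) (L : ℕ) [NeZero L] (hL : Even L) (hnL : 4 * n + 2 ≤ L) (δ : Fin 3 × Bool),
      (∑ x ∈ box 3 n, ∑ y ∈ box 3 n,
        if (zdGraph 3).Adj x y then
          ∑' nc : edgesIn (torusGraph 3 L) univ → ℕ,
            ind (csources (torusGraph 3 L) univ nc = ∅ ∧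
                CSupp (torusGraph 3 L) univ (edgesIn (torusGraph 3 L) univ) nc) *
              cweight (torusGraph 3 L) univ (criticalBeta 3) nc *
              (ind (¬ (isFoldable_dir hL (by omega) n δ).ConnFix ((isFoldable_dir hL (by omega) n δ).fold nc)
                      (Torus.proj L (0 : Site 3)) ∧
                    ¬ (isFoldable_dir hL (by omega) n δ).ConnFix ((isFoldable_dir hL (by omega) n δ).fold nc)
                      (Torus.proj L x) ∧
                    (isFoldable_dir hL (by omega) n δ).ConnFix ((isFoldable_dir hL (by omega) n δ).fold nc)
                      (Torus.proj L y)) *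
                ENNReal.ofReal (isingTwoPoint (torusGraph 3 L)
                  (((box 3 n).filter fun z => ¬ (isFoldable_dir hL (by omega) n δ).ConnFix
                      ((isFoldable_dir hL (by omega) n δ).fold nc) (Torus.proj L z)).image (Torus.proj L))
                  (criticalBeta 3) 0 .free (Torus.proj L (0 : Site 3)) (Torus.proj L x)))
        else 0) ≤
      ENNReal.ofReal (C * (n : ℝ) ^ (-s)) *
        ∑ x ∈ box 3 n, ∑ y ∈ box 3 n,
          if (zdGraph 3).Adj x y then
            (currentZ (torusGraph 3 L) univ (criticalBeta 3) (edgesIn (torusGraph 3 L) univ)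
                  ({Torus.proj L (0 : Site 3)} ∆ {Torus.proj L x}) -
                currentZ (torusGraph 3 L) univ (criticalBeta 3) (edgesIn (torusGraph 3 L) univ)
                  ({Torus.proj L (0 : Site 3)} ∆ {dirTheta L n δ (Torus.proj L x)})) *
              ENNReal.ofReal (isingTwoPoint (torusGraph 3 L) univ (criticalBeta 3) 0 .free (Torus.proj L y)
                (dirTheta L n δ (Torus.proj L y)))
          else 0)
    (hML : MoebiusLimit) : _root_.Ising3DConformalLimit :=
  SubPtolemyFloorHybrid.conditionalEta_closes hI (conditionalEta_of_screeningGain hE) hML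

/-- **Calibration: `STL25(0,1)` is a theorem** — with gain exponent `s = 0` and constant `C = 1` the screened
torus Lemma 2.5 is Duminil-Copin–Panis' Lemma 2.5 on the even torus (the tree's `DCPLower.lemma25_torus`)
summed over the neighbour pairs of `Λ_n`; hence the engine's format is exactly the printed one and its
content is the exponent `s > 0.4569`. [cite: DuminilCopinPanis2025LowerBounds, Lemma 2.5] -/
theorem screenedLemma25_zero_one :
    ∀ (n : ℕ) (_hn : 1 ≤ n) (L : ℕ) [NeZero L] (hL : Even L) (hnL : 4 * n + 2 ≤ L) (δ : Fin 3 × Bool),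
      (∑ x ∈ box 3 n, ∑ y ∈ box 3 n,
        if (zdGraph 3).Adj x y then
          ∑' nc : edgesIn (torusGraph 3 L) univ → ℕ,
            ind (csources (torusGraph 3 L) univ nc = ∅ ∧
                CSupp (torusGraph 3 L) univ (edgesIn (torusGraph 3 L) univ) nc) *
              cweight (torusGraph 3 L) univ (criticalBeta 3) nc *
              (ind (¬ (isFoldable_dir hL (by omega) n δ).ConnFix ((isFoldable_dir hL (by omega) n δ).fold nc)
                      (Torus.proj L (0 : Site 3)) ∧
                    ¬ (isFoldable_dir hL (by omega) n δ).ConnFix ((isFoldable_dir hL (by omega) n δ).fold nc)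
                      (Torus.proj L x) ∧
                    (isFoldable_dir hL (by omega) n δ).ConnFix ((isFoldable_dir hL (by omega) n δ).fold nc)
                      (Torus.proj L y)) *
                ENNReal.ofReal (isingTwoPoint (torusGraph 3 L)
                  (((box 3 n).filter fun z => ¬ (isFoldable_dir hL (by omega) n δ).ConnFix
                      ((isFoldable_dir hL (by omega) n δ).fold nc) (Torus.proj L z)).image (Torus.proj L))
                  (criticalBeta 3) 0 .free (Torus.proj L (0 : Site 3)) (Torus.proj L x)))
        else 0) ≤
      ENNReal.ofReal (1 * (n : ℝ) ^ (-(0 : ℝ))) *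
        ∑ x ∈ box 3 n, ∑ y ∈ box 3 n,
          if (zdGraph 3).Adj x y then
            (currentZ (torusGraph 3 L) univ (criticalBeta 3) (edgesIn (torusGraph 3 L) univ)
                  ({Torus.proj L (0 : Site 3)} ∆ {Torus.proj L x}) -
                currentZ (torusGraph 3 L) univ (criticalBeta 3) (edgesIn (torusGraph 3 L) univ)
                  ({Torus.proj L (0 : Site 3)} ∆ {dirTheta L n δ (Torus.proj L x)})) *
              ENNReal.ofReal (isingTwoPoint (torusGraph 3 L) univ (criticalBeta 3) 0 .free (Torus.proj L y)
                (dirTheta L n δ (Torus.proj L y)))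
          else 0 := by
  intro n hn L _ hL hnL δ
  rw [neg_zero, Real.rpow_zero, mul_one, ENNReal.ofReal_one, one_mul]
  refine Finset.sum_le_sum fun x hx => Finset.sum_le_sum fun y hy => ?_
  split_ifs with hxy
  · exact DCPLower.lemma25_torus (criticalBeta 3) (criticalBeta_nonneg 3) le_rfl n hn L hL hnL δ x hx y hy hxy
  · exact le_rfl

/-! ### The window of the engine: gains `s > 1` are impossible (infrared bound) -/

/-- **No screened axial lower bound with gain `s > 1`.** The infrared bound `⟨σ₀σ_x⟩_{β_c} ≤ C₀/‖x‖`
(`twoPointFree_le_of_le_criticalBeta`) makes the denominator of (1.9) at most `A n²`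
(`screenedDenominator_le` with `b = 0`) and the left point value at most `C₀/n`, so
`c₁ n^{s} ≤ C₀ A n`, impossible for large `n` when `s > 1`. Hence the line's currencies are asked exactly
in the window `0.4569 < s ≤ 1` (unconditionally; under `η`-existence `s ≤ 1 - 2η`).
[cite: DuminilCopinPanis2025LowerBounds, Theorem 1.3 (the shape of (1.9)); infrared bound as in §1 after (1.2)] -/
theorem screenedAxisLower_false_of_one_lt (s : ℝ) (hs : 1 < s) :
    ¬ (∃ c₁ : ℝ, 0 < c₁ ∧ ∃ N₁ : ℕ, 0 < N₁ ∧ ∀ n : ℕ, N₁ ≤ n →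
      c₁ * (n : ℝ) ^ s / ((∑ x ∈ box 3 (4 * n), twoPointFree 3 (criticalBeta 3) x) +
            (n : ℝ) ^ (3 - 2) *
              ∑ k ∈ Finset.Icc 1 (2 * n),
                (k : ℝ) * twoPointFree 3 (criticalBeta 3) (Pi.single (⟨0, by omega⟩ : Fin 3) (k : ℤ)))
        ≤ twoPointFree 3 (criticalBeta 3) (Pi.single (⟨0, by omega⟩ : Fin 3) (n : ℤ))) := by
  rintro ⟨c₁, hc₁, N₁, -, hmain⟩
  -- `G(0) = 1`, `G ≥ 0` (Griffiths)
  have hF0 : twoPointFree 3 (criticalBeta 3) 0 = 1 := twoPointFree_zero 3 _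
  have hFnn : ∀ x, 0 ≤ twoPointFree 3 (criticalBeta 3) x :=
    twoPointFree_nonneg' (criticalBeta_nonneg 3)
  -- the infrared bound in the form `G(x) ≤ K‖x‖^{-(1+0)}`
  obtain ⟨K, hK, hFle⟩ : ∃ K : ℝ, 0 < K ∧ ∀ x : Site 3, x ≠ 0 →
      twoPointFree 3 (criticalBeta 3) x ≤ K * ‖x‖ ^ (-(1 + (0 : ℝ))) := by
    obtain ⟨C₀, hC₀, hIR⟩ := twoPointFree_le_of_le_criticalBeta (d := 3) (by norm_num)
    refine ⟨C₀, hC₀, fun x hx => ?_⟩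
    have h := hIR (criticalBeta 3) (criticalBeta_nonneg 3) le_rfl x hx
    have hxpos : (0 : ℝ) < ‖x‖ := norm_pos_iff.2 hx
    rw [show (3 - 2 : ℕ) = 1 from rfl, pow_one] at h
    rwa [show -(1 + (0 : ℝ)) = -1 by ring, Real.rpow_neg_one, ← one_div]
  -- the denominator of (1.9) is `≤ A n^{2}` for `n ≥ 1`
  obtain ⟨A, hDleA⟩ : ∃ A : ℝ, ∀ m : ℕ, 1 ≤ m →
      (∑ x ∈ box 3 (4 * m), twoPointFree 3 (criticalBeta 3) x) +
          (m : ℝ) * ∑ k ∈ Finset.Icc 1 (2 * m),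
            (k : ℝ) * twoPointFree 3 (criticalBeta 3) (Pi.single (⟨0, by norm_num⟩ : Fin 3) (k : ℤ)) ≤
        A * (m : ℝ) ^ (2 - (0 : ℝ)) :=
    ⟨_, fun m hm => screenedDenominator_le hK (by norm_num) hF0 hFle (⟨0, by norm_num⟩ : Fin 3) hm⟩
  have hbs : 1 - 2 * (0 : ℝ) - s < 0 := by linarith
  -- `K A n^{1-s} → 0`
  have hlim : Tendsto (fun n : ℕ => K * A * (n : ℝ) ^ (1 - 2 * (0 : ℝ) - s)) atTop (𝓝 0) := by
    have h1 : Tendsto (fun t : ℝ => t ^ (1 - 2 * (0 : ℝ) - s)) atTop (𝓝 0) := by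
      have := tendsto_rpow_neg_atTop (y := -(1 - 2 * (0 : ℝ) - s)) (by linarith)
      simpa only [neg_neg] using this
    have h2 : Tendsto (fun n : ℕ => (n : ℝ) ^ (1 - 2 * (0 : ℝ) - s)) atTop (𝓝 0) :=
      h1.comp tendsto_natCast_atTop_atTop
    simpa only [mul_zero] using h2.const_mul (K * A)
  obtain ⟨n, hnlt, hnge⟩ :=
    ((hlim.eventually (gt_mem_nhds hc₁)).and (eventually_ge_atTop (max N₁ 1))).exists
  have hnN : N₁ ≤ n := le_of_max_le_left hnge
  have hn1 : 1 ≤ n := le_of_max_le_right hnge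
  have htpos : (0 : ℝ) < n := by exact_mod_cast hn1
  have h19 := hmain n hnN
  rw [show (3 - 2 : ℕ) = 1 from rfl, pow_one] at h19
  have hne : (Pi.single (⟨0, by norm_num⟩ : Fin 3) ((n : ℕ) : ℤ) : Site 3) ≠ 0 := by
    intro h
    have h0 := congr_fun h ⟨0, by norm_num⟩
    simp at h0
    omega
  have hup : twoPointFree 3 (criticalBeta 3) (Pi.single (⟨0, by norm_num⟩ : Fin 3) ((n : ℕ) : ℤ)) ≤
      K * (n : ℝ) ^ (-(1 + (0 : ℝ))) := by
    have := hFle _ hne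
    rwa [Pi.norm_single, Int.norm_natCast] at this
  have hDpos := dcp_denominator_pos hF0 hFnn (⟨0, by norm_num⟩ : Fin 3) n
  have hdiv := (div_le_iff₀ hDpos).1 (h19.trans hup)
  have hns : 0 < (n : ℝ) ^ s := Real.rpow_pos_of_pos htpos s
  have hchain : c₁ * (n : ℝ) ^ s ≤ K * A * (n : ℝ) ^ (1 - 2 * (0 : ℝ) - s) * (n : ℝ) ^ s := by
    calc c₁ * (n : ℝ) ^ s ≤ K * (n : ℝ) ^ (-(1 + (0 : ℝ))) * _ := hdiv
      _ ≤ K * (n : ℝ) ^ (-(1 + (0 : ℝ))) * (A * (n : ℝ) ^ (2 - (0 : ℝ))) :=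
          mul_le_mul_of_nonneg_left (hDleA n hn1) (by positivity)
      _ = K * A * ((n : ℝ) ^ (-(1 + (0 : ℝ))) * (n : ℝ) ^ (2 - (0 : ℝ))) := by ring
      _ = K * A * (n : ℝ) ^ (1 - 2 * (0 : ℝ) - s + s) := by
          rw [← Real.rpow_add htpos, show -(1 + (0 : ℝ)) + (2 - 0) = 1 - 2 * 0 - s + s by ring]
      _ = K * A * (n : ℝ) ^ (1 - 2 * (0 : ℝ) - s) * (n : ℝ) ^ s := by
          rw [Real.rpow_add htpos]
          ring
  have hlt : K * A * (n : ℝ) ^ (1 - 2 * (0 : ℝ) - s) * (n : ℝ) ^ s < c₁ * (n : ℝ) ^ s :=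
    mul_lt_mul_of_pos_right hnlt hns
  linarith

/-- **No screened reflected-gradient inequality with gain `s > 1`** (through S2 and the previous
theorem). [cite: DuminilCopinPanis2025LowerBounds, Theorems 1.2–1.3] -/
theorem screenedGradient_false_of_one_lt (s : ℝ) (hs : 1 < s) :
    ¬ (∃ c₀ : ℝ, 0 < c₀ ∧ ∃ N₀ : ℕ, 0 < N₀ ∧ ∀ n : ℕ, N₀ ≤ n →
      c₀ * (n : ℝ) ^ s ≤ ∑ x ∈ box 3 n, ∑ y ∈ box 3 n,
        if (zdGraph 3).Adj x y then
          (twoPointFree 3 (criticalBeta 3) x -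
              twoPointFree 3 (criticalBeta 3) (dcpReflect (⟨0, by omega⟩ : Fin 3) (n : ℤ) x)) *
            freeExpect 3 (criticalBeta 3) 0
              (spinPair y (dcpReflect (⟨0, by omega⟩ : Fin 3) (n : ℤ) y))
        else 0) := fun h12 =>
  screenedAxisLower_false_of_one_lt s hs (screenedAxisLower_of_screenedGradient s (by linarith) h12)

/-- **The engine's window: no screened torus Lemma 2.5 with gain `s > 1`** (any `C > 0`), through S1–S2
and the infrared bound. Together with the threshold `s > 3 - 2·log₂(1+√2) = 0.4569` of the composition,
the engine stub `stub_screenedLemma25` is asked exactly for `s ∈ (0.4569, 1]` (truth, if the bootstrap value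
`η = 0.036` and the box-face heuristic are right: `s_max ≈ 0.93 - 0.2`). [cite: DuminilCopinPanis2025LowerBounds, Lemma 2.5 and Theorems 1.2–1.3] -/
theorem screenedLemma25_false_of_one_lt (s C : ℝ) (hs : 1 < s) (hC : 0 < C) :
    ¬ (∀ (n : ℕ) (_hn : 1 ≤ n) (L : ℕ) [NeZero L] (hL : Even L) (hnL : 4 * n + 2 ≤ L) (δ : Fin 3 × Bool),
      (∑ x ∈ box 3 n, ∑ y ∈ box 3 n,
        if (zdGraph 3).Adj x y then
          ∑' nc : edgesIn (torusGraph 3 L) univ → ℕ,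
            ind (csources (torusGraph 3 L) univ nc = ∅ ∧
                CSupp (torusGraph 3 L) univ (edgesIn (torusGraph 3 L) univ) nc) *
              cweight (torusGraph 3 L) univ (criticalBeta 3) nc *
              (ind (¬ (isFoldable_dir hL (by omega) n δ).ConnFix ((isFoldable_dir hL (by omega) n δ).fold nc)
                      (Torus.proj L (0 : Site 3)) ∧
                    ¬ (isFoldable_dir hL (by omega) n δ).ConnFix ((isFoldable_dir hL (by omega) n δ).fold nc)
                      (Torus.proj L x) ∧
                    (isFoldable_dir hL (by omega) n δ).ConnFix ((isFoldable_dir hL (by omega) n δ).fold nc)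
                      (Torus.proj L y)) *
                ENNReal.ofReal (isingTwoPoint (torusGraph 3 L)
                  (((box 3 n).filter fun z => ¬ (isFoldable_dir hL (by omega) n δ).ConnFix
                      ((isFoldable_dir hL (by omega) n δ).fold nc) (Torus.proj L z)).image (Torus.proj L))
                  (criticalBeta 3) 0 .free (Torus.proj L (0 : Site 3)) (Torus.proj L x)))
        else 0) ≤
      ENNReal.ofReal (C * (n : ℝ) ^ (-s)) *
        ∑ x ∈ box 3 n, ∑ y ∈ box 3 n,
          if (zdGraph 3).Adj x y then
            (currentZ (torusGraph 3 L) univ (criticalBeta 3) (edgesIn (torusGraph 3 L) univ)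
                  ({Torus.proj L (0 : Site 3)} ∆ {Torus.proj L x}) -
                currentZ (torusGraph 3 L) univ (criticalBeta 3) (edgesIn (torusGraph 3 L) univ)
                  ({Torus.proj L (0 : Site 3)} ∆ {dirTheta L n δ (Torus.proj L x)})) *
              ENNReal.ofReal (isingTwoPoint (torusGraph 3 L) univ (criticalBeta 3) 0 .free (Torus.proj L y)
                (dirTheta L n δ (Torus.proj L y)))
          else 0) := fun hE =>
  screenedGradient_false_of_one_lt s hs (screenedGradient_of_screenedLemma25 s C (by linarith) hC hE)

end Summit.CriticalPhenomena.Ising3DConformalLimit.SubPtolemyFloorScreening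

end
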